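import Summits.AtomisticToContinuum.Crystallization.Theses.SoftAnnulusKernel
import Summits.AtomisticToContinuum.Crystallization.Theses.FlatToriSuffice
import Summits.AtomisticToContinuum.Crystallization.Theorems.HullMinimalityLayeredWindowsCore
import Summits.AtomisticToContinuum.Crystallization.Theorems.PhononSlackCertificatesPeriodicGivenLayered
import Summits.AtomisticToContinuum.Crystallization.Theorems.NashClassCertificatesNashHullBridge
import Literature.MathematicalPhysics.StatisticalMechanics.LocalLimitOfGroundStates

/-!
# Crux-ideate sketch (ideator k = 2, round 1) for `SoftAnnulusKernel.ClosePackedCrystallizes`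
(stmt-AtomisticToContinuum-12080).  First lemmas of the two idea cards:

* card A `coarse-clean-core` : `closePackedCrystallizes_of_coarseCleanCore` (REAL proof over landed glue) and the
  transfer target `CoarseBarlowLiouville`;
* card B `rebate-torus-thinning` : `closePackedCrystallizes_of_thinning` (REAL proof over landed glue), the engine
  `RebateTorusGap` and the bridge `RebateBridge`.

Both compositions route 12080 into the LANDED machinery of crux 11778 (`layeredWindows_of_core`,
`windowsOfGluing_freq stub_layeredGluing`), 11779 (`PeriodicGivenLayered_of`) and 3240 (`stub_hullCriterion`).
-/

noncomputable section

open scoped BigOperators Classical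
open Filter Topology

namespace Summit.AtomisticToContinuum.Crystallization.Cruxes.ClosePackedCrystallizes.IdeatorTwo

open Summit.AtomisticToContinuum.Crystallization.Theses
open Summit.AtomisticToContinuum.Crystallization.Theorems
open Summit.AtomisticToContinuum.Crystallization.Theorems.LayeredWindowsLocal
open Summit.AtomisticToContinuum.Crystallization.Theorems.PrestressSplitKorn
open Summit.AtomisticToContinuum.Crystallization.Theorems.DefectFreeCrystallizes.Negative.PredicateAPI (Good)
open Literature.MathematicalPhysics.StatisticalMechanics Literature.Geometry.DiscreteGeometry

/-- `ℝ³`. -/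
abbrev E3 := EuclideanSpace ℝ (Fin 3)

/-! ## The crux's own goodness predicate (verbatim the body of `LocalClosePacking`, scale `a`) -/

/-- **Coarse goodness** of particle `i` at the GLOBAL scale `a`: the rescaled shell of ALL particles within `1.001·a`
is `1/10`-matched (after an isometry) to the fcc or the hcp kissing pattern.  Verbatim the predicate negated inside
`SoftAnnulusKernel.LocalClosePacking`. -/
def CoarseGood (a : ℝ) {N : ℕ} (x : Fin N → E3) (i : Fin N) : Prop :=
  ∃ T : Finset E3, (↑T : Set E3) = (fun j : Fin N => a⁻¹ • (x j - x i)) '' {j : Fin N | j ≠ i ∧ dist (x i) (x j) ≤ (1 + 1 / 1000) * a} ∧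
    (ShellCloseTo (1 / 10) T fccKissingPattern ∨ ShellCloseTo (1 / 10) T hcpKissingPattern)

/-- **Counting (provable now, proved here): `o(N)` coarse-bad particles ⇒ all-coarse-good `ρ`-balls for all large `N`.**
Same packing argument as the landed `goodWindows_of_badFraction` (`hb_exists_far_from` + the `1/3`-separation of
ground states), with the predicate swapped. -/
theorem coarseGoodBalls_of_badFraction (a : ℝ) (x : (N : ℕ) → (Fin N → E3))
    (hx : ∀ N, IsGroundState lennardJones (x N))
    (hbad : Tendsto (fun N : ℕ => (Nat.card {i : Fin N // ¬ CoarseGood a (x N) i} : ℝ) / N) atTop (𝓝 0))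
    (ρ : ℝ) :
    ∀ᶠ N : ℕ in atTop, ∃ i : Fin N, ∀ j : Fin N, dist (x N j) (x N i) ≤ ρ → CoarseGood a (x N) j := by
  classical
  set M : ℝ := (2 * max ρ 0 / (1 / 3) + 1) ^ 3 with hM
  have ht : Tendsto (fun N : ℕ => M * ((Nat.card {i : Fin N // ¬ CoarseGood a (x N) i} : ℝ) / N))
      atTop (𝓝 0) := by simpa using hbad.const_mul M
  filter_upwards [ht.eventually_lt_const zero_lt_one, eventually_gt_atTop 0] with N hN1 hN0
  have hNpos : (0 : ℝ) < N := by exact_mod_cast hN0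
  set D := Finset.univ.filter fun i : Fin N => ¬ CoarseGood a (x N) i with hD
  have hDcard : (Nat.card {i : Fin N // ¬ CoarseGood a (x N) i} : ℝ) = D.card := by
    rw [Nat.card_eq_fintype_card, Fintype.card_subtype]
  rw [hDcard, ← mul_div_assoc, div_lt_iff₀ hNpos, one_mul] at hN1
  have hsep : ∀ i j : Fin N, i ≠ j → (1 / 3 : ℝ) ≤ dist (x N i) (x N j) := fun i j hij =>
    ZeroDefectDensity.third_le_dist_of_isGroundState (hx N) hij
  obtain ⟨i, hi⟩ := hb_exists_far_from (x N) (by norm_num : (0 : ℝ) < 1 / 3) (le_max_right ρ 0) hsep D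
    (by rw [mul_comm]; exact hN1)
  refine ⟨i, fun j hj => ?_⟩
  by_contra hbadj
  exact hi j (hj.trans (le_max_left _ _)) (Finset.mem_filter.2 ⟨Finset.mem_univ _, hbadj⟩)

/-! ## Card A — `coarse-clean-core` -/

/-- **Coarse clean core** (card A's residue; the 12080-twin of 11778's registered stub S2' `stub_cleanCoreOfGoodBall`,
whose hypothesis is two-shell goodness at `1/20`): for every `η > 0` and radius `R'` there is a radius `ρ` such that in
every Lennard-Jones GROUND STATE, an all-COARSE-good `ρ`-ball (12080's `1/10`, cap `1.001 a`, common scale `a`) forces a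
CLEAN `R'`-centre (`Good ∧ LayeredNear η`, the input of the landed `windowsOfGluing_freq`).  Qualitative, minimisers
only, all-good regions only, ONE centre. -/
def CoarseCleanCore (a : ℝ) : Prop :=
  ∀ η : ℝ, 0 < η → ∀ R' : ℝ, ∃ ρ : ℝ, ∀ (N : ℕ) (y : Fin N → E3), IsGroundState lennardJones y →
    ∀ i₀ : Fin N, (∀ j : Fin N, dist (y j) (y i₀) ≤ ρ → CoarseGood a y j) →
      ∃ i : Fin N, ∀ j : Fin N, dist (y j) (y i) ≤ R' → Good y j ∧ LayeredNear η y j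

/-- **FIRST LEMMA of card A (real proof, landed glue only): the crux from the coarse clean core.**
`LocalClosePacking` ⟹ (counting) all-coarse-good balls of every radius eventually ⟹ (`CoarseCleanCore`) clean centres
frequently ⟹ (`windowsOfGluing_freq stub_layeredGluing`, landed) layered windows ⟹ (`PeriodicGivenLayered_of`, 11779,
landed) periodic windows ⟹ (`stub_hullCriterion`, 3240, landed) `IsCrystallizing lennardJones 3`. -/
theorem closePackedCrystallizes_of_coarseCleanCore (hcore : ∀ a : ℝ, 0 < a → CoarseCleanCore a) :
    SoftAnnulusKernel.ClosePackedCrystallizes := by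
  rintro ⟨a, ha, hgood⟩
  refine PrestressSplitKorn.stub_hullCriterion ?_
  intro x hx
  have hbad : Tendsto (fun N : ℕ => (Nat.card {i : Fin N // ¬ CoarseGood a (x N) i} : ℝ) / N) atTop (𝓝 0) :=
    hgood x hx
  have hcentre : ∀ η : ℝ, 0 < η → ∀ R' : ℝ, ∃ᶠ N : ℕ in atTop, ∃ i : Fin N, ∀ j : Fin N,
      dist (x N j) (x N i) ≤ R' → Good (x N) j ∧ LayeredNear η (x N) j := by
    intro η hη R'
    obtain ⟨ρ, hρ⟩ := hcore a ha η hη R'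
    exact ((coarseGoodBalls_of_badFraction a x hx hbad ρ).frequently).mono
      fun N ⟨i₀, hi₀⟩ => hρ N (x N) (hx N) i₀ hi₀
  exact LayeredHull.PeriodicGivenLayered_of x hx (windowsOfGluing_freq stub_layeredGluing x hx hcentre)

/-- **Limit-robust coarse goodness of a point of an infinite configuration** (closed under local limits of finite
coarse-good shells): twelve points of `X` in the CLOSED `1.001a`-ball, exhausting `X` in the OPEN ball, `1/10`-close to
a kissing pattern after rescaling by `a⁻¹`. -/
def CoarseGoodSet (a : ℝ) (X : Set E3) (y : E3) : Prop :=
  ∃ T : Finset E3, (↑T : Set E3) ⊆ X ∧ (∀ t ∈ T, t ≠ y ∧ dist y t ≤ (1 + 1 / 1000) * a) ∧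
    (∀ q ∈ X, q ≠ y → dist y q < (1 + 1 / 1000) * a → q ∈ T) ∧
    (ShellCloseTo (1 / 10) (T.image fun t => a⁻¹ • (t - y)) fccKissingPattern ∨
      ShellCloseTo (1 / 10) (T.image fun t => a⁻¹ • (t - y)) hcpKissingPattern)

/-- **Transfer target of card A — COARSE BARLOW LIOUVILLE.**  A local limit `X` of Lennard-Jones ground states
(`IsLocalLimitOfGroundStates`, hence a hard-core GSC by the landed 14086) in which EVERY point is coarse-good at one
scale `a` contains, for every `ε > 0` and `R'`, an `R'`-ball on which it is `ε`-two-shell-fcc/hcp at a scale in the box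
`[47/50, 1]`.  Deterministic, infinite-volume, defect-free by hypothesis; the finite-`N` `CoarseCleanCore` follows by
local compactness + openness (bridge `LiouvilleBridge`). -/
def CoarseBarlowLiouville (a : ℝ) : Prop :=
  ∀ X : Set E3, IsLocalLimitOfGroundStates lennardJones 3 X → (∀ y ∈ X, CoarseGoodSet a X y) →
    ∀ ε : ℝ, 0 < ε → ∀ R' : ℝ, ∃ c : E3, ∀ y ∈ X, dist y c ≤ R' → IsTwoShellGoodSet ε (47 / 50) 1 X y

/-- **Bridge (support, compactness; provable now modulo routine matching lemmas):** Liouville for everywhere-coarse-good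
local limits gives the finite-`N` coarse clean core (contraposition: ground states `y_n` with all-coarse-good
`ρ_n`-balls, `ρ_n → ∞`, and no clean `R'`-centre; recentre, extract a local limit `X` — everywhere `CoarseGoodSet`
by closedness — apply Liouville at `ε ≪ η`, pull exact two-shell order back to `y_n` by openness and the landed
two-shell ⇒ `Good ∧ LayeredNear` template lemmas). -/
def LiouvilleBridge : Prop :=
  (∀ a : ℝ, 0 < a → CoarseBarlowLiouville a) → ∀ a : ℝ, 0 < a → CoarseCleanCore a

/-! ## Card B — `rebate-torus-thinning` -/

/-- **Two-shell thinning** (card B's target): under `LocalClosePacking`, all but `o(N)` particles of a ground state are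
TWO-SHELL good at tolerance `1/20` and a scale in `[47/50, 1]` — exactly the hypothesis of the landed
`goodWindows_of_badFraction`, i.e. 11778's positional core S1 in its a.e. form. -/
def TwoShellThinning : Prop :=
  SoftAnnulusKernel.LocalClosePacking → ∀ x : (N : ℕ) → (Fin N → E3), (∀ N, IsGroundState lennardJones (x N)) →
    Tendsto (fun N : ℕ => (Nat.card {i : Fin N // ¬ IsTwoShellGood (1 / 20) (47 / 50) 1 (x N) i} : ℝ) / N) atTop (𝓝 0)

/-- 11778's registered stub S2' `stub_cleanCoreOfGoodBall`, verbatim (shared work with the live lead of 11778;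
⇐ item 16827 by the landed `cleanCentre_of_goodBall`). -/
def CleanCoreOfGoodBall : Prop :=
  ∀ η : ℝ, 0 < η → ∀ R' : ℝ, ∃ ρ : ℝ, ∀ (N : ℕ) (y : Fin N → E3), IsGroundState lennardJones y →
    ∀ i₀ : Fin N, (∀ j : Fin N, dist (y j) (y i₀) ≤ ρ → IsTwoShellGood (1 / 20) (47 / 50) 1 y j) →
      ∃ i : Fin N, ∀ j : Fin N, dist (y j) (y i) ≤ R' → Good y j ∧ LayeredNear η y j

/-- **FIRST LEMMA of card B (real proof, landed glue only): the crux from two-shell thinning and S2'.** -/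
theorem closePackedCrystallizes_of_thinning (hT : TwoShellThinning) (h2 : CleanCoreOfGoodBall) :
    SoftAnnulusKernel.ClosePackedCrystallizes := by
  intro hL
  refine PrestressSplitKorn.stub_hullCriterion ?_
  intro x hx
  have h1 : ∀ x : (N : ℕ) → (Fin N → E3), (∀ N, IsGroundState lennardJones (x N)) → ∀ ρ : ℝ,
      ∃ᶠ N : ℕ in atTop, ∃ i : Fin N, ∀ j : Fin N,
        dist (x N j) (x N i) ≤ ρ → IsTwoShellGood (1 / 20) (47 / 50) 1 (x N) j :=
    fun x' hx' ρ => (goodWindows_of_badFraction x' hx' (hT hL x' hx') ρ).frequently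
  exact LayeredHull.PeriodicGivenLayered_of x hx (layeredWindows_of_core h1 h2 x hx)

/-- **Card B's engine — REBATE TORUS GAP at the coarse tolerance.**  For every scale `a > 0` there are `c > 0` and a
rebate `C` such that EVERY periodic configuration `P` of `ℝ³` satisfies
`e(P) ≥ e_per + c·θ_dist(P) − C·θ_bad(P)`, where `θ_bad` is the motif fraction of points that are NOT coarse-good
(12080's predicate, limit-robust set form) and `θ_dist` the fraction of points that ARE coarse-good but NOT two-shell
good at `(1/20, [47/50, 1])`.  Bad (frustrated, amorphous, porous, icosahedral) matter is REBATED, never priced: the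
inequality is blind to the Kepler-hard regime of `PeriodicStarCoercivity` (13602), which implies it with `C = 0`. -/
def RebateTorusGap (a : ℝ) : Prop :=
  ∃ c C : ℝ, 0 < c ∧ ∀ P : PeriodicConfiguration 3,
    (⨅ Q : PeriodicConfiguration 3, Q.energyPerParticle lennardJones)
      + c * (((P.motif.filter fun s => CoarseGoodSet a P.points s ∧ ¬ IsTwoShellGoodSet (1 / 20) (47 / 50) 1 P.points s).card : ℝ) / P.motif.card)
      - C * (((P.motif.filter fun s => ¬ CoarseGoodSet a P.points s).card : ℝ) / P.motif.card)
      ≤ P.energyPerParticle lennardJones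

/-- **Bridge (support): rebate gap + whole-cluster padding periodisation ⇒ two-shell thinning.**  Periodise the whole
ground state `x N` with padding `R ≥ 3` (`FlatToriSuffice.PeriodisationWithWindows`, stmt-11953: motif `= range x`,
`N·e(P_N) ≤ E(N)` because `V ≤ 0` beyond `1`, shells of radius `≤ 3/2` read identically on the torus); then
`c·θ_dist(P_N) ≤ E(N)/N − e_per + C·θ_bad(P_N) → 0` by `CrysEnergyUpper`/`crysEnergyLimit` (landed) and
`LocalClosePacking`; surface particles are `O(N^{2/3})`. -/
def RebateBridge : Prop :=
  (∀ a : ℝ, 0 < a → RebateTorusGap a) → FlatToriSuffice.PeriodisationWithWindows → TwoShellThinning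

end Summit.AtomisticToContinuum.Crystallization.Cruxes.ClosePackedCrystallizes.IdeatorTwo

end
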